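import Summits.AtomisticToContinuum.Crystallization.Theorems.FreeSplittingCertificatesStrictSplittingRuleP1Certificates
import Summits.AtomisticToContinuum.Crystallization.Theorems.FreeSplittingCertificatesStrictSplittingRuleP1TwoSiteLedgerExact

/-!
# `StrictSplittingRule` (stmt-AtomisticToContinuum-12560): THE ENDPOINT with the per-cell budget in EXACT-DEFECT form — H12⋆ `CoreJointCoercive a h κ₁ κ₃` from the certificates (P1 interpolant object, part 72)

Route `FreeSplittingCertificates`, crux r3 `StrictSplittingRule` (H12⋆ = `stub_coreJointCoercive`), unit b2b-freesplit-B gen 34.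
VALUE = part 60 (`coreJointCoercive_of_certificates`) RE-THREADED on part 71: the same conditional closure of H12⋆ from the six certificate-tier
statements (B), (NC), (S), (TAB), (PAY), (FLX) and the bookkeeping hypotheses, EXCEPT that (B) is now the per-cell budget with the EXACT vertex-quadrature
defect `p1CellDefectG` (part 68) — the statement the interval tier certifies (HOME CERT §31; gen-34 audit §34) — and the circumradius data are gone.
NOT a proof of H12⋆: the six statements are hypotheses verified OUTSIDE the kernel.  NOT summit progress.  [folklore]
-/

noncomputable section

open Set Function Metric MeasureTheory Filter Topology
open scoped BigOperators NNReal ENNReal Classical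

namespace Summit.AtomisticToContinuum.Crystallization.Theorems.StrictSplittingRuleBirth

open Literature.MathematicalPhysics.StatisticalMechanics
open Summit.AtomisticToContinuum.Crystallization.Theorems.PalmUnimodularRigidity.LayeredLawsSelectHcp

/-- **THE ENDPOINT (exact defect): H12⋆ FROM THE CERTIFICATES.**  See the module docstring.  NOT a proof of H12⋆, NOT summit progress. -/
theorem coreJointCoercive_of_certificates_exact {a h κ₁ κ₃ : ℝ} (ha : 0 < a) (hh : 0 < h) (hfam : HcpFamilyMin a h)
    (Y₁ : Finset (ℤ × ℤ × ℤ)) (β : Bool → (ℤ × ℤ × ℤ) → (ℤ × ℤ × ℤ) → ℝ)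
    (hY₁ : ∀ b d s, s ∉ Y₁ → β b d s = 0)
    {Cβ : ℝ} (hβ : ∀ p q : ℤ × ℤ × ℤ, ∀ s, |β (decide (Even p.1)) (q - p) s| ≤ Cβ * ((1 + ‖hcpSite a h q - hcpSite a h p‖)⁻¹) ^ 6)
    (hH1 : ∀ u : ℤ × ℤ × ℤ → EuclideanSpace ℝ (Fin 3), (support u).Finite →
      ∀ p ∈ ({(0, 0, 0), (1, 0, 0)} : Finset (ℤ × ℤ × ℤ)),
        (∑' q : ℤ × ℤ × ℤ, (if q = p then (0 : ℝ) else
            ljSqDeriv (‖hcpSite a h q - hcpSite a h p‖ ^ 2) *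
              inner ℝ (hcpSite a h q - hcpSite a h p) (u q - u p))) +
          (∑' q : ℤ × ℤ × ℤ, (if q = p then (0 : ℝ) else
            ∑ s ∈ Y₁, (β (decide (Even p.1)) (q - p) s *
                inner ℝ (hcpSite a h (p + s) - hcpSite a h p) (u (p + s) - u p) -
              β (decide (Even q.1)) (p - q) s *
                inner ℝ (hcpSite a h (q + s) - hcpSite a h q) (u (q + s) - u q)))) = 0)
    (M₁ N M : Bool → (ℤ × ℤ × ℤ) → (ℤ × ℤ × ℤ) → (ℤ × ℤ × ℤ) → ℝ)
    (hMN₁ : ∀ b d s s', s ∉ p1BondOffsets ∨ s' ∉ p1BondOffsets → M₁ b d s s' = 0 ∧ N b d s s' = 0)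
    {C₁ : ℝ} (hdec₁ : ∀ p q : ℤ × ℤ × ℤ, ∀ s s', |M₁ (decide (Even p.1)) (q - p) s s'| ≤
        C₁ * ((1 + ‖hcpSite a h q - hcpSite a h p‖)⁻¹) ^ 6 ∧
      |N (decide (Even p.1)) (q - p) s s'| ≤ C₁ * ((1 + ‖hcpSite a h q - hcpSite a h p‖)⁻¹) ^ 6)
    {R1 R2 : ℝ} (hR1 : 0 < R1) (hR12 : R1 < R2) {κ : ℝ} (hκ : 0 ≤ κ)
    (hM : ∀ b e s s', M b e s s' = M₁ b e s s' + (fun b e s s' => if s = s' then -(κ * (2 / 5) / a ^ 4 * p1RecTable a h (p1SplitDensity R1 R2) b e s) else 0) b e s s')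
    -- per representative: in-layer far shares and their allocation table
    (w : (ℤ × ℤ × ℤ) → (ℤ × ℤ × ℤ) × (ℤ × ℤ × ℤ) → ℝ) (hw : ∀ p ∈ ({(0, 0, 0), (1, 0, 0)} : Finset (ℤ × ℤ × ℤ)), ∀ e, 0 ≤ w p e)
    (hws : ∀ p ∈ ({(0, 0, 0), (1, 0, 0)} : Finset (ℤ × ℤ × ℤ)),
      Summable fun e : (ℤ × ℤ × ℤ) × (ℤ × ℤ × ℤ) => w p e * fpSq (fun k => hcpSite a h (e.1 + e.2) k - hcpSite a h e.1 k))
    (θ : (ℤ × ℤ × ℤ) → (ℤ × ℤ × ℤ) × (ℤ × ℤ × ℤ) → (ℤ × ℤ × ℤ) × Fin 6 → ℝ) (hθ : ∀ p ∈ ({(0, 0, 0), (1, 0, 0)} : Finset (ℤ × ℤ × ℤ)), ∀ e T, 0 ≤ θ p e T)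
    (hfinE : ∀ p ∈ ({(0, 0, 0), (1, 0, 0)} : Finset (ℤ × ℤ × ℤ)), ∀ e, (Function.support (θ p e)).Finite)
    (hfinC : ∀ p ∈ ({(0, 0, 0), (1, 0, 0)} : Finset (ℤ × ℤ × ℤ)), ∀ T, (Function.support fun e => θ p e T).Finite)
    (hsum : ∀ p ∈ ({(0, 0, 0), (1, 0, 0)} : Finset (ℤ × ℤ × ℤ)), ∀ e, w p e ≠ 0 → ∑ᶠ T, θ p e T = 1)
    (hcar : ∀ p ∈ ({(0, 0, 0), (1, 0, 0)} : Finset (ℤ × ℤ × ℤ)), ∀ e T, θ p e T ≠ 0 → ∃ m m' : Fin 4, e.1 = T.1 + p1VertOff (p1Par T.1) T.2 m ∧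
      e.1 + e.2 = T.1 + p1VertOff (p1Par T.1) T.2 m')
    -- per representative: vertical far shares, routing offsets and their allocation table
    (sv : (ℤ × ℤ × ℤ) → ℤ × ℤ × ℤ) (o : (ℤ × ℤ × ℤ) → (ℤ × ℤ × ℤ) → Fin 3 → ℤ × ℤ × ℤ) (S : Finset (ℤ × ℤ × ℤ))
    (ho : ∀ p ∈ ({(0, 0, 0), (1, 0, 0)} : Finset (ℤ × ℤ × ℤ)), ∀ q i, o p q i ∈ S)
    (wv : (ℤ × ℤ × ℤ) → (ℤ × ℤ × ℤ) → ℝ) (hwv : ∀ p ∈ ({(0, 0, 0), (1, 0, 0)} : Finset (ℤ × ℤ × ℤ)), ∀ q, 0 ≤ wv p q)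
    (hwvs : ∀ p ∈ ({(0, 0, 0), (1, 0, 0)} : Finset (ℤ × ℤ × ℤ)), Summable (wv p))
    (θv : (ℤ × ℤ × ℤ) → (ℤ × ℤ × ℤ) × (ℤ × ℤ × ℤ) → (ℤ × ℤ × ℤ) × Fin 6 → ℝ) (hθv : ∀ p ∈ ({(0, 0, 0), (1, 0, 0)} : Finset (ℤ × ℤ × ℤ)), ∀ e T, 0 ≤ θv p e T)
    (hfinEv : ∀ p ∈ ({(0, 0, 0), (1, 0, 0)} : Finset (ℤ × ℤ × ℤ)), ∀ e, (Function.support (θv p e)).Finite)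
    (hfinCv : ∀ p ∈ ({(0, 0, 0), (1, 0, 0)} : Finset (ℤ × ℤ × ℤ)), ∀ T, (Function.support fun e => θv p e T).Finite)
    (hsumv : ∀ p ∈ ({(0, 0, 0), (1, 0, 0)} : Finset (ℤ × ℤ × ℤ)), ∀ e, (∑ i : Fin 3, (2 / 3) * ((if e.2 = o p e.1 i then wv p e.1 else 0) +
        (if o p (e.1 - (sv p - e.2)) i = sv p - e.2 then wv p (e.1 - (sv p - e.2)) else 0))) ≠ 0 → ∑ᶠ T, θv p e T = 1)
    (hcarv : ∀ p ∈ ({(0, 0, 0), (1, 0, 0)} : Finset (ℤ × ℤ × ℤ)), ∀ e T, θv p e T ≠ 0 → ∃ m m' : Fin 4, e.1 = T.1 + p1VertOff (p1Par T.1) T.2 m ∧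
      e.1 + e.2 = T.1 + p1VertOff (p1Par T.1) T.2 m')
    -- THE PER-CELL BUDGET (B) at each representative: dyad readout + EXACT defect form (part 68), weights re-centred at `y_p`
    (hB : ∀ p ∈ ({(0, 0, 0), (1, 0, 0)} : Finset (ℤ × ℤ × ℤ)), ∀ (T : (ℤ × ℤ × ℤ) × Fin 6) (G : Fin 3 → Fin 3 → ℝ),
      (∑ᶠ e : (ℤ × ℤ × ℤ) × (ℤ × ℤ × ℤ), θ p e T * w p e *
          fpSq (fun k => (hcpSite a h (e.1 + e.2) 0 - hcpSite a h e.1 0) * G 0 k +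
            (hcpSite a h (e.1 + e.2) 1 - hcpSite a h e.1 1) * G 1 k + (hcpSite a h (e.1 + e.2) 2 - hcpSite a h e.1 2) * G 2 k)) +
      (∑ᶠ e : (ℤ × ℤ × ℤ) × (ℤ × ℤ × ℤ), θv p e T *
          (∑ i : Fin 3, (2 / 3) * ((if e.2 = o p e.1 i then wv p e.1 else 0) +
            (if o p (e.1 - (sv p - e.2)) i = sv p - e.2 then wv p (e.1 - (sv p - e.2)) else 0))) *
          fpSq (fun k => (hcpSite a h (e.1 + e.2) 0 - hcpSite a h e.1 0) * G 0 k +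
            (hcpSite a h (e.1 + e.2) 1 - hcpSite a h e.1 1) * G 1 k + (hcpSite a h (e.1 + e.2) 2 - hcpSite a h e.1 2) * G 2 k)) +
      p1CellDefectG a h (fun y k l => κ * ((7 * (5 / 4 : ℝ) + 3 / 4) / 4) * fpChi (R1 ^ 2) (R2 ^ 2) (y - fun k => hcpSite a h p k) ^ 2 *
          (fpSq (y - fun k => hcpSite a h p k))⁻¹ ^ 5 * ((y - fun k => hcpSite a h p k) k * (y - fun k => hcpSite a h p k) l)) T G ≤
      κ * ((5 / 2 * (1 / 24 * fpSymSq G) + 5 / 2 * (1 / 24 * (fpFrob G - fpSymSq G))) *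
        ∫ y in p1RealCell a h T, fpChi (R1 ^ 2) (R2 ^ 2) (y - fun k => hcpSite a h p k) ^ 2 * (fpSq (y - fun k => hcpSite a h p k))⁻¹ ^ 3))
    -- PER REPRESENTATIVE: the explicit first shell
    (SH : (ℤ × ℤ × ℤ) → Finset (ℤ × ℤ × ℤ))
    (hSH : ∀ p ∈ ({(0, 0, 0), (1, 0, 0)} : Finset (ℤ × ℤ × ℤ)), ∀ q : ℤ × ℤ × ℤ,
      (0 < ‖hcpSite a h q - hcpSite a h p‖ ∧ ‖hcpSite a h q - hcpSite a h p‖ ≤ 11 / 10 * a) ↔ q ∈ SH p)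
    -- (S) per-site domination off the reach set, (TAB) the hat-average tables on it
    (QB : (ℤ × ℤ × ℤ) → Finset (ℤ × ℤ × ℤ)) (L U : (ℤ × ℤ × ℤ) → (ℤ × ℤ × ℤ) → ℝ)
    (hS : ∀ p ∈ ({(0, 0, 0), (1, 0, 0)} : Finset (ℤ × ℤ × ℤ)), ∀ q : ℤ × ℤ × ℤ, q ∉ QB p → q ≠ p → ∀ z : Fin 3 → ℝ,
      0 ≤ 1 / 2 * (ljSqDeriv (‖hcpSite a h q - hcpSite a h p‖ ^ 2) * fpSq z +
          2 * (1 / 2 * (7 * ((‖hcpSite a h q - hcpSite a h p‖ ^ 2)⁻¹) ^ 8 -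
            4 * ((‖hcpSite a h q - hcpSite a h p‖ ^ 2)⁻¹) ^ 5)) * p1NRad a h p (fun _ => z) q ^ 2) +
        p1SiteBare a h (fun y k l => κ * ((7 * (5 / 4 : ℝ) + 3 / 4) / 4) * fpChi (R1 ^ 2) (R2 ^ 2) (y - fun k => hcpSite a h p k) ^ 2 *
          (fpSq (y - fun k => hcpSite a h p k))⁻¹ ^ 5 * ((y - fun k => hcpSite a h p k) k * (y - fun k => hcpSite a h p k) l)) (fun _ => z) q -
        p1SiteBare a h (fun y k l => κ * ((3 / 4 : ℝ) / 4) * fpChi (R1 ^ 2) (R2 ^ 2) (y - fun k => hcpSite a h p k) ^ 2 *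
          (fpSq (y - fun k => hcpSite a h p k))⁻¹ ^ 4 * (if k = l then 1 else 0)) (fun _ => z) q)
    (hTab : ∀ p ∈ ({(0, 0, 0), (1, 0, 0)} : Finset (ℤ × ℤ × ℤ)), ∀ q ∈ QB p, q ≠ p → ∀ z : Fin 3 → ℝ,
      L p q * p1NRad a h p (fun _ => z) q ^ 2 ≤
        p1SiteBare a h (fun y k l => κ * ((7 * (5 / 4 : ℝ) + 3 / 4) / 4) * fpChi (R1 ^ 2) (R2 ^ 2) (y - fun k => hcpSite a h p k) ^ 2 *
          (fpSq (y - fun k => hcpSite a h p k))⁻¹ ^ 5 * ((y - fun k => hcpSite a h p k) k * (y - fun k => hcpSite a h p k) l)) (fun _ => z) q ∧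
      p1SiteBare a h (fun y k l => κ * ((3 / 4 : ℝ) / 4) * fpChi (R1 ^ 2) (R2 ^ 2) (y - fun k => hcpSite a h p k) ^ 2 *
          (fpSq (y - fun k => hcpSite a h p k))⁻¹ ^ 4 * (if k = l then 1 else 0)) (fun _ => z) q ≤ U p q * fpSq z)
    -- the near tables vanish off QT
    (QT : (ℤ × ℤ × ℤ) → Finset (ℤ × ℤ × ℤ))
    (hQT : ∀ p ∈ ({(0, 0, 0), (1, 0, 0)} : Finset (ℤ × ℤ × ℤ)), ∀ q : ℤ × ℤ × ℤ, q ∉ QT p → ∀ s s',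
      M₁ (decide (Even p.1)) (q - p) s s' = 0 ∧ M₁ (decide (Even q.1)) (p - q) s s' = 0 ∧
      N (decide (Even p.1)) (q - p) s s' = 0 ∧ N (decide (Even q.1)) (p - q) s' s = 0)
    -- the far shares take at least the full load off LEG
    (LEG : (ℤ × ℤ × ℤ) → Finset ((ℤ × ℤ × ℤ) × (ℤ × ℤ × ℤ)))
    (hwfar : ∀ p ∈ ({(0, 0, 0), (1, 0, 0)} : Finset (ℤ × ℤ × ℤ)), ∀ e : (ℤ × ℤ × ℤ) × (ℤ × ℤ × ℤ), e ∉ LEG p →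
      (if e.1 ≠ p ∧ e.2 ∈ Y₁ then 1 / 2 * β (decide (Even e.1.1)) (p - e.1) e.2 else 0) ≤ w p e + (if e.2 = sv p then wv p e.1 else 0))
    -- the column sums of β
    (colβ : (ℤ × ℤ × ℤ) → (ℤ × ℤ × ℤ) → ℝ)
    (hcol : ∀ p ∈ ({(0, 0, 0), (1, 0, 0)} : Finset (ℤ × ℤ × ℤ)), ∀ s ∈ Y₁,
      HasSum (fun q : ℤ × ℤ × ℤ => if q = p then (0 : ℝ) else β (decide (Even p.1)) (q - p) s) (colβ p s))
    -- (PAY) the far table's column-sum enclosures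
    (PAYM : (ℤ × ℤ × ℤ) → (ℤ × ℤ × ℤ) → ℝ)
    (hPAY : ∀ p ∈ ({(0, 0, 0), (1, 0, 0)} : Finset (ℤ × ℤ × ℤ)), ∀ s ∈ p1BondOffsets, κ * (2 / 5) / a ^ 4 *
      (∑' q : ℤ × ℤ × ℤ, p1RecTable a h (p1SplitDensity R1 R2) (decide (Even p.1)) (q - p) s) ≤ PAYM p s)
    -- the flux form vanishes off CELLS, (FLX) the flux enclosure
    (CELLS : (ℤ × ℤ × ℤ) → Finset ((ℤ × ℤ × ℤ) × Fin 6))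
    (hCELLS : ∀ p ∈ ({(0, 0, 0), (1, 0, 0)} : Finset (ℤ × ℤ × ℤ)), ∀ i, i ∉ CELLS p → ∀ Wv : Fin 4 → Fin 3 → ℝ,
      p1FluxQuad₀ (R1 ^ 2) (R2 ^ 2) (1 / 3) (4 / 3) (-9 / 8) (1 / 8) a h (fun k => hcpSite a h p k) i Wv = 0)
    (QF : (ℤ × ℤ × ℤ) → Finset (ℤ × ℤ × ℤ)) (FL0 : (ℤ × ℤ × ℤ) → (ℤ × ℤ × ℤ) × Fin 3 → (ℤ × ℤ × ℤ) × Fin 3 → ℝ)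
    (Δ : (ℤ × ℤ × ℤ) → (ℤ × ℤ × ℤ) → ℝ)
    (hFlux : ∀ p ∈ ({(0, 0, 0), (1, 0, 0)} : Finset (ℤ × ℤ × ℤ)), ∀ V : ℤ × ℤ × ℤ → (Fin 3 → ℝ),
      ∑ i ∈ CELLS p, p1FluxQuad₀ (R1 ^ 2) (R2 ^ 2) (1 / 3) (4 / 3) (-9 / 8) (1 / 8) a h (fun k => hcpSite a h p k) i (p1CellVals V i) ≤
        p1NearFlux (FL0 p) (Δ p) (QF p) V)
    -- (NC) THE NEAR CERTIFICATE on the least-squares constraint set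
    (hNC : ∀ p ∈ ({(0, 0, 0), (1, 0, 0)} : Finset (ℤ × ℤ × ℤ)), ∀ V : ℤ × ℤ × ℤ → (Fin 3 → ℝ), V p = 0 →
      (∀ Z : Fin 3 → Fin 3 → ℝ, (∀ j k, Z j k = -Z k j) →
        ∑ q ∈ SH p, ∑ k : Fin 3, V q k * (∑ j : Fin 3, (hcpSite a h q j - hcpSite a h p j) * Z j k) = 0) →
      0 ≤ p1NearForm a h κ₁ κ₃ κ p Y₁ β M₁ N (w p) (sv p) (wv p) (colβ p) (SH p) (QB p) (QT p) (QF p) (LEG p) (L p) (U p) (PAYM p) (Δ p) (FL0 p) V) :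
    CoreJointCoercive a h κ₁ κ₃ :=
  coreJointCoercive_of_ledgers_exact ha hh hfam Y₁ β hY₁ hβ hH1 M₁ N M hMN₁ hdec₁ hR1 hR12 hκ hM w hw hws θ hθ hfinE hfinC hsum hcar
    sv o S ho wv hwv hwvs θv hθv hfinEv hfinCv hsumv hcarv hB
    fun p hp u hu W hWskew hWLS A hA =>
      nearLedger_of_finite ha hh Y₁ β hβ M₁ N hR1 hR12 hκ u hu p W hWskew hWLS A hA (w p) (hw p hp) (hws p hp) (sv p) (wv p) (hwv p hp) (hwvs p hp)
        (SH p) (hSH p hp) (QB p) (L p) (U p) (hS p hp) (hTab p hp) (QT p) (hQT p hp) (LEG p) (hwfar p hp) (colβ p) (hcol p hp)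
        (PAYM p) (hPAY p hp) (CELLS p) (hCELLS p hp) (QF p) (FL0 p) (Δ p) (hFlux p hp) (hNC p hp)

end Summit.AtomisticToContinuum.Crystallization.Theorems.StrictSplittingRuleBirth

end
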